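import Mathlib
import HarnessLib
import Summits.ValiantsHypothesis.ValiantsHypothesis.Theorems.DefinabilityGapAffineRung
import Literature.Computability.AlgebraicComplexity.ValiantConjectureEquivProofs
import Literature.Computability.AlgebraicComplexity.KRSTDesign
import Literature.Computability.AlgebraicComplexity.DetInVP

/-!
# DefinabilityGap — seed exposure: the exposed KI-planted generator is a costume (`K1⁺ ⟹ VP_ℂ ≠ VNP_ℂ`)

[topic Summits/ValiantsHypothesis/ValiantsHypothesis/Theorems]

Support for `stmt-ValiantsHypothesis-23547` (`KIPlantedHitting`, K1, the declared residual of `route-ValiantsHypothesis-DefinabilityGap`):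
the PIT-axis trichotomy of the decomp-valiant workshop (lens 5, NODE v3) made precise in the kernel. K1 says the HIDDEN-seed map
`y ↦ G_m(y) = (per_m(y|S_c))_{c ∈ 𝔽_q³}` (`kiPer m`) hits size/degree-`q^b` circuits infinitely often; it is implied by `VP ≠ VNP`
(`Theorems.DefinabilityGapK1Necessary`). The SEED-EXPOSED map `y ↦ (y, G_m(y))` — the substitution
`Sum.elim X (kiPer m)` on the variables `(𝔽_q × 𝔽_q) ⊕ 𝔽_q³` — with the same quantifier shape (K1⁺, written inline below) is instead AT
LEAST THE SUMMIT: `vh_of_kiPlantedHittingExposed : K1⁺ → VP_ℂ ≠ VNP_ℂ`, because under the collapse `L(per_m) ≤ m^c + c`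
(`isPComputable_perPoly_complex_iff`) and the explicit annihilator `z_c − per_m(y|S_c)` then has size `≤ L(per_m) + 2 ≤ q^{c+2}` and
degree `≤ m + 1`. (The converse `VP ≠ VNP ⟹ K1⁺` is Kabanets–Impagliazzo's hybrid argument with seed-reading adversaries, Thm. 7.7 —
not re-run here.) Reading for the route: hidden seed = residual, exposed seed = costume; the route's Transfer residual `K2c ⟺ (K1 → VH)`
is exactly seed elimination `K1 → K1⁺`. No `def` is declared (the witness is written inline). HONEST: `VP ≠ VNP` is not proved.

References: [KabanetsImpagliazzo2003] Comput. Complexity 13 (2004), Lemma 7.6 / Thm. 7.7; [Burgisser2000] Prop. 2.20.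
-/

noncomputable section

open MvPolynomial
open Literature.Computability.AlgebraicComplexity
open Summit.ValiantsHypothesis.ValiantsHypothesis.Theorems.DefinabilityGapAffineRung (qOf qOf_spec sq_le_qOf quadDesign kiPer)

namespace Summit.ValiantsHypothesis.ValiantsHypothesis.Theorems.DefinabilityGapSeedExposure

/-- The exposed map kills the explicit witness `z_c − per_m(y|S_c)`. [cite: KabanetsImpagliazzo2003, Lemma 7.6] -/
theorem bind₁_exposed_witness (m : ℕ) (c : Fin 3 → Fin (qOf m)) :
    bind₁ (Sum.elim (X : Fin (qOf m) × Fin (qOf m) → MvPolynomial (Fin (qOf m) × Fin (qOf m)) ℂ) (kiPer m))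
      ((X (Sum.inr c) : MvPolynomial ((Fin (qOf m) × Fin (qOf m)) ⊕ (Fin 3 → Fin (qOf m))) ℂ) - rename Sum.inl (kiPer m c)) = 0 := by
  rw [map_sub, bind₁_X_right, bind₁_rename]
  have h : (Sum.elim (X : Fin (qOf m) × Fin (qOf m) → MvPolynomial (Fin (qOf m) × Fin (qOf m)) ℂ) (kiPer m) ∘ Sum.inl) =
      (X : Fin (qOf m) × Fin (qOf m) → MvPolynomial (Fin (qOf m) × Fin (qOf m)) ℂ) := by
    funext p; rfl
  rw [h, bind₁_X_left, AlgHom.id_apply]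
  show kiPer m c - kiPer m c = 0
  exact sub_self _

/-- The witness `z_c − per_m(y|S_c)` is nonzero for `m ≥ 1` (evaluate at `y = 0`, `z = 𝟙_c`). [folklore] -/
theorem exposed_witness_ne_zero {m : ℕ} (hm : 1 ≤ m) (c : Fin 3 → Fin (qOf m)) :
    ((X (Sum.inr c) : MvPolynomial ((Fin (qOf m) × Fin (qOf m)) ⊕ (Fin 3 → Fin (qOf m))) ℂ) - rename Sum.inl (kiPer m c)) ≠ 0 := by
  intro h0
  have key := congrArg (eval (Sum.elim (fun _ => (0 : ℂ)) (fun c' => if c' = c then (1 : ℂ) else 0))) h0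
  rw [map_sub, eval_X, eval_rename, map_zero] at key
  have hcomp : (Sum.elim (fun _ => (0 : ℂ)) (fun c' => if c' = c then (1 : ℂ) else 0)) ∘ Sum.inl =
      fun _ : Fin (qOf m) × Fin (qOf m) => (0 : ℂ) := by funext p; rfl
  rw [hcomp] at key
  have hz : eval (fun _ : Fin (qOf m) × Fin (qOf m) => (0 : ℂ)) (kiPer m c) = 0 := by
    have : (fun _ : Fin (qOf m) × Fin (qOf m) => (0 : ℂ)) = 0 := rfl
    rw [this, eval_zero]
    show constantCoeff (kiGenerator (perPad ℂ (sq_le_qOf m)) (quadDesign m) c) = 0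
    rw [kiGenerator_apply, constantCoeff_rename]
    unfold perPad
    rw [constantCoeff_rename, constantCoeff_eq]
    -- `per_m` is homogeneous of degree `m ≥ 1`, so its constant coefficient vanishes
    -- (also landed as `Theorems.ChowBorderDepth3LocalFanInTwo.constantCoeff_perPoly`, whose module imports another route's Theses file)
    show coeff 0 (perPoly (Fin m) ℂ) = 0
    refine (perPoly_isHomogeneous (n := Fin m) (k := ℂ)).coeff_eq_zero ?_
    rw [map_zero, Fintype.card_fin]
    omega
  rw [hz] at key
  simp at key

/-- Size of the witness: `L(z_c − per_m(y|S_c)) ≤ L(per_m) + 2`. [cite: KabanetsImpagliazzo2003, Lemma 7.6] -/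
theorem complexity_exposed_witness_le (m : ℕ) (c : Fin 3 → Fin (qOf m)) :
    complexity ((X (Sum.inr c) : MvPolynomial ((Fin (qOf m) × Fin (qOf m)) ⊕ (Fin 3 → Fin (qOf m))) ℂ) - rename Sum.inl (kiPer m c))
      ≤ complexity (perPoly (Fin m) ℂ) + 2 := by
  rw [sub_eq_add_neg]
  refine (complexity_add_le_holds _ _).trans ?_
  rw [complexity_X_holds]
  set R : MvPolynomial ((Fin (qOf m) × Fin (qOf m)) ⊕ (Fin 3 → Fin (qOf m))) ℂ := rename Sum.inl (kiPer m c) with hR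
  have h1 : complexity (-R) ≤ complexity R + 1 := complexity_neg_le _
  have h2 : complexity R ≤ complexity (kiPer m c) := complexity_rename_le_holds' _ _
  have h3 : complexity (kiPer m c) ≤ complexity (perPoly (Fin m) ℂ) := by
    show complexity (kiGenerator (perPad ℂ (sq_le_qOf m)) (quadDesign m) c) ≤ _
    rw [kiGenerator_apply]
    exact (complexity_rename_le_holds' _ _).trans (complexity_perPad (F := ℂ) (sq_le_qOf m)).le
  omega

/-- Degree of the witness: `≤ m + 1`. [folklore] -/
theorem totalDegree_exposed_witness_le (m : ℕ) (c : Fin 3 → Fin (qOf m)) :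
    ((X (Sum.inr c) : MvPolynomial ((Fin (qOf m) × Fin (qOf m)) ⊕ (Fin 3 → Fin (qOf m))) ℂ) - rename Sum.inl (kiPer m c)).totalDegree
      ≤ m + 1 := by
  refine (totalDegree_sub _ _).trans (max_le ?_ ?_)
  · rw [totalDegree_X]; omega
  · refine (totalDegree_rename_le _ _).trans ?_
    show (kiGenerator (perPad ℂ (sq_le_qOf m)) (quadDesign m) c).totalDegree ≤ _
    rw [kiGenerator_apply]
    exact (totalDegree_rename_le _ _).trans ((totalDegree_perPad_le (F := ℂ) (sq_le_qOf m)).trans (by omega))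

/-- Arithmetic: `m^c + c + 2 ≤ q^(c+2)` once `m ≤ q` and `2 ≤ q`. [folklore] -/
theorem pow_bound (m q c : ℕ) (hq : 2 ≤ q) (hmq : m ≤ q) : m ^ c + c + 2 ≤ q ^ (c + 2) := by
  have h1 : m ^ c ≤ q ^ c := Nat.pow_le_pow_left hmq c
  have h2 : c < 2 ^ c := Nat.lt_two_pow_self
  have h3 : 2 ^ c ≤ q ^ c := Nat.pow_le_pow_left hq c
  have h4 : 1 ≤ q ^ c := Nat.one_le_pow _ _ (by omega)
  have h5 : q ^ (c + 2) = q ^ c * (q * q) := by ring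
  have h6 : 4 ≤ q * q := by nlinarith
  rw [h5]
  nlinarith

/-- **The exposed generator is a costume: `K1⁺ ⟹ VP_ℂ ≠ VNP_ℂ`** (kernel). K1⁺ = "the seed-exposed map `y ↦ (y, G_m(y))` is an
i.o. hitting-set generator for size/degree-`q^b` circuits" with K1's quantifier shape; under `VP_ℂ = VNP_ℂ`, `L(per_m) ≤ m^c + c`, so
`z_c − per_m(y|S_c)` is a nonzero annihilator of size `≤ q^{c+2}` and degree `≤ m + 1 ≤ q^{c+2}` at every `m ≥ 1`, contradicting K1⁺
at level `b = c + 2`. [cite: KabanetsImpagliazzo2003, Lemma 7.6, Thm. 7.7] -/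
theorem vh_of_kiPlantedHittingExposed
    (h : ∀ b m₀ : ℕ, ∃ m, m₀ ≤ m ∧
      ∀ D : MvPolynomial ((Fin (qOf m) × Fin (qOf m)) ⊕ (Fin 3 → Fin (qOf m))) ℂ, D ≠ 0 →
        complexity D ≤ qOf m ^ b → D.totalDegree ≤ qOf m ^ b →
          bind₁ (Sum.elim (X : Fin (qOf m) × Fin (qOf m) → MvPolynomial (Fin (qOf m) × Fin (qOf m)) ℂ) (kiPer m)) D ≠ 0) :
    VP ℂ ≠ VNP ℂ := by
  intro hEq
  obtain ⟨c, hc⟩ := isPComputable_perPoly_complex_iff.2 hEq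
  obtain ⟨m, hm, hhit⟩ := h (c + 2) 1
  have hq : m * m + 1 ≤ qOf m ∧ (qOf m).Prime := qOf_spec m
  have hq2 : 2 ≤ qOf m := hq.2.two_le
  have hmq : m ≤ qOf m := by nlinarith [hq.1]
  haveI : NeZero (qOf m) := ⟨hq.2.ne_zero⟩
  let c₀ : Fin 3 → Fin (qOf m) := fun _ => 0
  refine hhit _ (exposed_witness_ne_zero hm c₀) ?_ ?_ (bind₁_exposed_witness m c₀)
  · have hcm : complexity (perPoly (Fin m) ℂ) ≤ m ^ c + c := hc m
    exact ((complexity_exposed_witness_le m c₀).trans (by omega)).trans (pow_bound m (qOf m) c hq2 hmq)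
  · refine (totalDegree_exposed_witness_le m c₀).trans ?_
    calc m + 1 ≤ qOf m := by nlinarith [hq.1]
      _ ≤ qOf m ^ (c + 2) := Nat.le_self_pow (by omega) _

end Summit.ValiantsHypothesis.ValiantsHypothesis.Theorems.DefinabilityGapSeedExposure

end
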